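import Literature.Probability.Percolation.VoronoiRSW
import HarnessLib

/-!
# Tassion's RSW theory for Voronoi percolation, II: good scales (Lemma 2.2), renormalisation of
# scales (§3), Theorem 1, and the annealed one-arm estimate `VoronoiAnnealedOneArm`

Topic `Probability/Percolation`; everything is proved, no named fact is introduced.  Continuation of
`VoronoiRSW.lean` (see its docstring for the conventions: weak-black continuum crossings of
annealed two-colour Poisson–Voronoi percolation at `p = 1/2`, the events `H_s(α, β)`, the level
`α_s`, the four-legged event `X_s(α)`, the annulus event `A_s`), following V. Tassion, *Crossing
probabilities for Voronoi percolation*, Ann. Probab. 44 (2016), Lemma 2.2 and §3 [Tassion2016].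

**Lemma 2.2 (good scales).**  A scale `s` is GOOD if `α_s = s/4` or `α_s ≤ 2 α_{2s/3}`; at a
good scale `f_s(4) = P[lrCross 0 (4s) 0 s] ≥ 2⁻²⁰⁶` (`measureReal_f4_ge_of_good`; all constants of
this file are explicit powers of `1/2`, since `c₀ = 1/2`), hence `P[A_s] ≥ 2⁻⁸²⁴`:
* case `α_s = s/4` (`measureReal_f2_ge_of_alphaS_eq`): four translated copies of `X_s(s/4)` in the
  squares `[0, s] × [a_i - s/2, a_i + s/2]`, `a_i = s/4 + i s/2`, glued by the gate lemma
  (`inter_nonempty_of_gate_left`) into a top–bottom crossing of `[0, s] × [0, 2s]` (Tassion's `E_i`);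
* case `α_s < s/4`, `α_s ≤ 2α'`, `α' = α_{2s/3}` (`measureReal_f43_ge_of_alphaS_le`): `X_{2s/3}(α')`,
  `E = H_s(0, 2α') + (-s/6, -α')` and its mirror image `E'` glued by the gate lemma on both sides of
  `B_{s/3}` into a left–right crossing of the `4s/3 × s` rectangle (Fig. 5); `P[E] ≥ 3/16` is (P2) in
  value form, valid at `α = 2α' ≥ α_s` by right-continuity, so the NON-STRICT condition suffices;
* then Cor. 1.3 (2) (`measureReal_lrCross_chain`).

**§3.**
* Locality of the annulus event (`preimage_restrictPair_annLoc`): on `nucleiNear 0 (3s/4)` the event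
  `A_s` is an event of the configuration restricted to `localityRegion 0 (3s/4)` (Lemma 1.1), so
  annulus events at scales in ratio `9` are independent (`measure_iInter_restrictPair_preimage`).
* Lemma 3.1 (`measureReal_f2_ge_of_annEv`, `measureReal_annEv_ge_cThree`): `P[A_s] ≥ c`, `t ≥ 4s`,
  `α_t < s` give `f_t(2) ≥ (3/16)² c` (the crossings `E₁ = H_t(0, s) + (-t/2, 0)` and its mirror
  image meet the hooks of `A_s` by the gate lemma), hence `P[A_t] ≥ c₃ = 2⁻⁹⁹⁵⁶` for `c = 2⁻⁸²⁴`.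
* Lemma 3.2 (`exists_alphaS_ge`): for `s` beyond the locality threshold with `P[A_s] ≥ 2⁻⁸²⁴` some
  `s' ∈ [4s, C₁ s]` has `α_{s'} ≥ s` (scales `4·9^i s`, `t = C₁ s = 4·9^{N+1} s`, `N` with
  `(1 - c₃/2)^N < 1/8`; the event "`H_t(0, s)` but not `H_t(s, t/2)`", translated, has probability
  `≥ 1/8` by (P2) and is incompatible with each `A_{4·9^i s}` by the gate lemma; independence and
  locality bound its probability by `(1 - c₃/2)^N < 1/8`).  Ratio `9` (instead of Tassion's `5`)
  because the locality regions of `VoronoiArmEstimatesProofs` are `u/2 < |x| < 9u/2`.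
* Lemma 3.3 (`exists_isGoodScale_ge`, `exists_isGoodScale_mem_Icc`, `exists_goodSeq`): good scales
  exist beyond every threshold, and after a good scale there is another in `[4s, C₃ s]`.
* **Theorem 1, `ρ = 4`, weak continuum form** (`weakRSW`) and the named fact
  **`VoronoiAnnealedOneArm_holds`** via `VoronoiAnnealedOneArm_of_weakRSW`
  (`VoronoiContinuumCrossings.lean`): Tassion's Theorem 3 (2).

## References

* V. Tassion, Ann. Probab. 44 (2016) 3385–3398, Lemma 2.2, §3 (Lemmas 3.1–3.3), §4, Thm 1, Thm 3. [Tassion2016]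
-/

noncomputable section

namespace Literature.Probability.Percolation

open _root_.MeasureTheory _root_.ProbabilityTheory _root_.Filter _root_.Set _root_.Metric Complex
open scoped _root_.Topology _root_.ENNReal _root_.NNReal
open Literature.Analysis.FunctionSpaces
open Literature.Topology.PlaneTopology


/-! ### Translated and reflected copies of the basic events: deterministic content -/

section Copies

variable {s α β : ℝ} {v : ℂ} {ω : (PointConfig ℂ × PointConfig ℂ)}

/-- The translation `z ↦ z - v` is an isometry. [folklore] -/
theorem isometry_addRight_neg (v : ℂ) : Isometry (Homeomorph.addRight (-v) : ℂ → ℂ) :=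
  (IsometryEquiv.addRight (-v)).isometry

/-- Translating the square. [folklore] -/
theorem preimage_addRight_neg_sqr (v : ℂ) (s : ℝ) :
    (Homeomorph.addRight (-v) : ℂ → ℂ) ⁻¹' sqr s =
      cRect (v.re - s / 2) (v.re + s / 2) (v.im - s / 2) (v.im + s / 2) := by
  ext z
  simp only [mem_preimage, Homeomorph.coe_addRight, mem_sqr, mem_cRect, add_re, neg_re, add_im, neg_im]
  constructor <;> rintro ⟨⟨h1, h2⟩, h3, h4⟩ <;>
    exact ⟨⟨by linarith, by linarith⟩, by linarith, by linarith⟩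

/-- **A translated `H_s(α, β)`** produces a weak-black continuum in the translated square from its
left side to the translated target segment. [cite: Tassion2016, Remark 2] -/
theorem exists_continuum_of_mem_preimage_hEv
    (h : pairImage (Homeomorph.addRight (-v)) ω ∈ hEv s α β) :
    ∃ K ⊆ blackRegion ((ω.1 : PointConfig ℂ) : Set ℂ) ((ω.2 : PointConfig ℂ) : Set ℂ) ∩
        cRect (v.re - s / 2) (v.re + s / 2) (v.im - s / 2) (v.im + s / 2),
      IsCompact K ∧ IsPreconnected K ∧ (∃ z ∈ K, z.re = v.re - s / 2) ∧
      ∃ z ∈ K, z.re = v.re + s / 2 ∧ v.im + α ≤ z.im ∧ z.im ≤ v.im + β := by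
  obtain ⟨C, hC, hCc, hCp, hA, hA'⟩ := h
  obtain ⟨hsub, hKc, hKp, hmeet⟩ := exists_continuum_preimage (isometry_addRight_neg v) hC hCc hCp
  rw [preimage_addRight_neg_sqr] at hsub
  refine ⟨_, hsub, hKc, hKp, ?_, ?_⟩
  · obtain ⟨z, hz, hz'⟩ := hmeet _ hA
    refine ⟨z, hz, ?_⟩
    simp only [mem_preimage, Homeomorph.coe_addRight, mem_setOf_eq, add_re, neg_re] at hz'
    linarith
  · obtain ⟨z, hz, hz'⟩ := hmeet _ hA'
    refine ⟨z, hz, ?_, ?_, ?_⟩ <;>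
      simp only [mem_preimage, Homeomorph.coe_addRight, rseg, mem_setOf_eq, add_re, neg_re, add_im,
        neg_im] at hz'
    · linarith [hz'.1]
    · linarith [hz'.2.1]
    · linarith [hz'.2.2]

/-- **A translated `X_s(α)`** produces a weak-black continuum in the translated square with the
four legs. [cite: Tassion2016, §2] -/
theorem exists_fourLegs_of_mem_preimage_xEv (hs : 0 < s)
    (h : pairImage (Homeomorph.addRight (-v)) ω ∈ xEv s α) :
    ∃ C ⊆ blackRegion ((ω.1 : PointConfig ℂ) : Set ℂ) ((ω.2 : PointConfig ℂ) : Set ℂ) ∩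
        cRect (v.re - s / 2) (v.re + s / 2) (v.im - s / 2) (v.im + s / 2),
      IsCompact C ∧ IsPreconnected C ∧
      (∃ z ∈ C, z.re = v.re + s / 2 ∧ v.im + α ≤ z.im ∧ z.im ≤ v.im + s / 2) ∧
      (∃ z ∈ C, z.re = v.re + s / 2 ∧ v.im - s / 2 ≤ z.im ∧ z.im ≤ v.im - α) ∧
      (∃ z ∈ C, z.re = v.re - s / 2 ∧ v.im + α ≤ z.im ∧ z.im ≤ v.im + s / 2) ∧
      (∃ z ∈ C, z.re = v.re - s / 2 ∧ v.im - s / 2 ≤ z.im ∧ z.im ≤ v.im - α) := by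
  obtain ⟨C, hC, hCc, hCp, h1, h2, h3, h4⟩ := exists_fourLegs_of_mem_xEv hs h
  obtain ⟨hsub, hKc, hKp, hmeet⟩ := exists_continuum_preimage (isometry_addRight_neg v) hC hCc hCp
  rw [preimage_addRight_neg_sqr] at hsub
  refine ⟨_, hsub, hKc, hKp, ?_, ?_, ?_, ?_⟩
  · obtain ⟨z, hz, hz'⟩ := hmeet _ h1
    simp only [mem_preimage, Homeomorph.coe_addRight, rseg, mem_setOf_eq, add_re, neg_re, add_im,
      neg_im] at hz'
    exact ⟨z, hz, by linarith [hz'.1], by linarith [hz'.2.1], by linarith [hz'.2.2]⟩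
  · obtain ⟨z, hz, hz'⟩ := hmeet _ h2
    simp only [mem_preimage, Homeomorph.coe_addRight, rseg, mem_setOf_eq, add_re, neg_re, add_im,
      neg_im] at hz'
    exact ⟨z, hz, by linarith [hz'.1], by linarith [hz'.2.1], by linarith [hz'.2.2]⟩
  · obtain ⟨z, hz, hz'⟩ := hmeet _ h3
    simp only [mem_preimage, Homeomorph.coe_addRight, lseg, mem_setOf_eq, add_re, neg_re, add_im,
      neg_im] at hz'
    exact ⟨z, hz, by linarith [hz'.1], by linarith [hz'.2.1], by linarith [hz'.2.2]⟩
  · obtain ⟨z, hz, hz'⟩ := hmeet _ h4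
    simp only [mem_preimage, Homeomorph.coe_addRight, lseg, mem_setOf_eq, add_re, neg_re, add_im,
      neg_im] at hz'
    exact ⟨z, hz, by linarith [hz'.1], by linarith [hz'.2.1], by linarith [hz'.2.2]⟩

/-- **The mirror image (in the imaginary axis) of a translated `H_s(α, β)`**.
[cite: Tassion2016, Remark 2] -/
theorem exists_continuum_of_mem_preimage_negConj_hEv
    (h : pairImage negConjLIE.toHomeomorph ω ∈ pairImage (Homeomorph.addRight (-v)) ⁻¹' hEv s α β) :
    ∃ K ⊆ blackRegion ((ω.1 : PointConfig ℂ) : Set ℂ) ((ω.2 : PointConfig ℂ) : Set ℂ) ∩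
        cRect (-(v.re + s / 2)) (-(v.re - s / 2)) (v.im - s / 2) (v.im + s / 2),
      IsCompact K ∧ IsPreconnected K ∧ (∃ z ∈ K, z.re = -(v.re - s / 2)) ∧
      ∃ z ∈ K, z.re = -(v.re + s / 2) ∧ v.im + α ≤ z.im ∧ z.im ≤ v.im + β := by
  obtain ⟨K₁, hK₁, hK₁c, hK₁p, ⟨a, ha, hare⟩, ⟨b, hb, hbre, hb1, hb2⟩⟩ :=
    exists_continuum_of_mem_preimage_hEv h
  have he : Isometry (negConjLIE.toHomeomorph : ℂ → ℂ) := negConjLIE.isometry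
  obtain ⟨hsub, hKc, hKp, hmeet⟩ := exists_continuum_preimage he hK₁ hK₁c hK₁p
  have hσ : ∀ z : ℂ, (negConjLIE.toHomeomorph z).re = -z.re ∧ (negConjLIE.toHomeomorph z).im = z.im :=
    fun z => by simp [LinearIsometryEquiv.coe_toHomeomorph]
  refine ⟨_, fun w hw => ⟨(hsub hw).1, ?_⟩, hKc, hKp, ?_, ?_⟩
  · have hw' := mem_cRect.1 (mem_preimage.1 (hsub hw).2)
    rw [(hσ w).1, (hσ w).2] at hw'
    exact mem_cRect.2 ⟨⟨by linarith [hw'.1.2], by linarith [hw'.1.1]⟩, hw'.2⟩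
  · obtain ⟨z, hz, hz'⟩ := hmeet {w | w.re = v.re - s / 2} ⟨a, ha, hare⟩
    refine ⟨z, hz, ?_⟩
    have : (negConjLIE.toHomeomorph z).re = v.re - s / 2 := hz'
    rw [(hσ z).1] at this
    linarith
  · obtain ⟨z, hz, hz'⟩ := hmeet {w | w.re = v.re + s / 2 ∧ v.im + α ≤ w.im ∧ w.im ≤ v.im + β}
      ⟨b, hb, hbre, hb1, hb2⟩
    have h' : (negConjLIE.toHomeomorph z).re = v.re + s / 2 ∧ v.im + α ≤ (negConjLIE.toHomeomorph z).im ∧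
        (negConjLIE.toHomeomorph z).im ≤ v.im + β := hz'
    rw [(hσ z).1, (hσ z).2] at h'
    exact ⟨z, hz, by linarith [h'.1], h'.2.1, h'.2.2⟩

end Copies

/-! ### Lemma 2.2, case `α_s = s/4` -/

section CaseA

variable {PB PW : Measure (PointConfig ℂ)} {s : ℝ}

/-- The four-legged continuum of a copy of `X_s(s/4)` centred at `(s/2, a)`: it lies in
`[0, s] × [a - s/2, a + s/2]`, reaches the right side, and has left legs in `{0} × [a + s/4, a + s/2]`
and `{0} × [a - s/2, a - s/4]`. [cite: Tassion2016, Lemma 2.2 (events E_i)] -/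
theorem exists_legs_caseA {ω : (PointConfig ℂ × PointConfig ℂ)} (hs : 0 < s) {a : ℝ}
    (h : pairImage (Homeomorph.addRight (-(⟨s / 2, a⟩ : ℂ))) ω ∈ xEv s (s / 4)) :
    ∃ C ⊆ blackRegion ((ω.1 : PointConfig ℂ) : Set ℂ) ((ω.2 : PointConfig ℂ) : Set ℂ) ∩
        cRect 0 s (a - s / 2) (a + s / 2),
      IsCompact C ∧ IsPreconnected C ∧ (∃ z ∈ C, z.re = s) ∧
      (∃ z ∈ C, z.re = 0 ∧ a + s / 4 ≤ z.im ∧ z.im ≤ a + s / 2) ∧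
      (∃ z ∈ C, z.re = 0 ∧ a - s / 2 ≤ z.im ∧ z.im ≤ a - s / 4) := by
  obtain ⟨C, hC, hCc, hCp, ⟨rh, hrh, hrh1, -, -⟩, -, ⟨lh, hlh, hlh1, hlh2, hlh3⟩, ⟨ll, hll, hll1, hll2, hll3⟩⟩ :=
    exists_fourLegs_of_mem_preimage_xEv hs h
  have hre : (⟨s / 2, a⟩ : ℂ).re = s / 2 := rfl
  have him : (⟨s / 2, a⟩ : ℂ).im = a := rfl
  rw [hre, him] at *
  refine ⟨C, fun w hw => ⟨(hC hw).1, ?_⟩, hCc, hCp, ⟨rh, hrh, by rw [hrh1]; ring⟩,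
    ⟨lh, hlh, by rw [hlh1]; ring, hlh2, hlh3⟩, ⟨ll, hll, by rw [hll1]; ring, hll2, by linarith⟩⟩
  have hw' := mem_cRect.1 (hC hw).2
  exact mem_cRect.2 ⟨⟨by linarith [hw'.1.1], by linarith [hw'.1.2]⟩, hw'.2⟩

/-- Consecutive copies (centres `(s/2, a)` and `(s/2, a + s/2)`) meet: gate lemma on the left side
of `[0, s] × [a - s/2, a + s]`. [cite: Tassion2016, Lemma 2.2 ("it implies a vertical black crossing")] -/
theorem legs_meet_caseA {Bk Wh : Set ℂ} (hs : 0 < s) {a : ℝ} {C C' : Set ℂ}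
    (hC : C ⊆ blackRegion Bk Wh ∩ cRect 0 s (a - s / 2) (a + s / 2)) (hCc : IsCompact C)
    (hCp : IsPreconnected C) (hCr : ∃ z ∈ C, z.re = s)
    (hClh : ∃ z ∈ C, z.re = 0 ∧ a + s / 4 ≤ z.im ∧ z.im ≤ a + s / 2)
    (hC' : C' ⊆ blackRegion Bk Wh ∩ cRect 0 s (a + s / 2 - s / 2) (a + s / 2 + s / 2))
    (hC'c : IsCompact C') (hC'p : IsPreconnected C')
    (hC'lh : ∃ z ∈ C', z.re = 0 ∧ a + s / 2 + s / 4 ≤ z.im ∧ z.im ≤ a + s / 2 + s / 2)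
    (hC'll : ∃ z ∈ C', z.re = 0 ∧ a + s / 2 - s / 2 ≤ z.im ∧ z.im ≤ a + s / 2 - s / 4) :
    (C ∩ C').Nonempty := by
  obtain ⟨p, hp, hpre, hp1, hp2⟩ := hClh
  obtain ⟨q₂, hq₂, hq₂re, hq₂1, -⟩ := hC'lh
  obtain ⟨q₁, hq₁, hq₁re, -, hq₁2⟩ := hC'll
  refine inter_nonempty_of_gate_left (a := 0) (b := s) (c := a - s / 2) (d := a + s / 2 + s / 2)
    (y := p.im) hs.le (by linarith) hCc hCp ?_ hCr ⟨p, hp, hpre, rfl⟩ hC'c hC'p ?_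
    ⟨q₁, hq₁, hq₁re, by linarith⟩ ⟨q₂, hq₂, hq₂re, by linarith⟩
  · intro w hw
    have h := mem_cRect.1 (hC hw).2
    exact mem_cRect.2 ⟨h.1, h.2.1, by linarith [h.2.2]⟩
  · intro w hw
    have h := mem_cRect.1 (hC' hw).2
    exact mem_cRect.2 ⟨h.1, by linarith [h.2.1], h.2.2⟩

/-- **Lemma 2.2, case `α_s = s/4`: `f_s(2) ≥ c₁⁴ = 2⁻⁶⁸`** (`c₁ = c₀ (c₀/8)⁴ = 2⁻¹⁷` for `c₀ = 1/2`).
Four translated copies of `X_s(s/4)` glued by the gate lemma give a top–bottom crossing of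
`[0, s] × [0, 2s]`. [cite: Tassion2016, Lemma 2.2 (first case)] -/
theorem measureReal_f2_ge_of_alphaS_eq (hB : IsPoissonPointProcess (volume : Measure ℂ) PB)
    (hW : IsPoissonPointProcess (volume : Measure ℂ) PW) (hs : 0 < s)
    (hA : alphaS (PB.prod PW) s = s / 4) :
    ((1 : ℝ) / 2) ^ 68 ≤ (PB.prod PW).real (lrCross 0 (2 * s) 0 s) := by
  haveI := hB.isProbabilityMeasure; haveI := hW.isProbabilityMeasure
  set μ := PB.prod PW with hμ
  have hc₁ : ((1 : ℝ) / 2) ^ 17 = (1 / 16) ^ 4 * (1 / 2) := by norm_num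
  -- the four copies, centred at `(s/2, s/4 + i s/2)`
  set v : ℕ → ℂ := fun i => ⟨s / 2, s / 4 + i * (s / 2)⟩ with hv
  set Ev : ℕ → Set (PointConfig ℂ × PointConfig ℂ) := fun i => pairImage (Homeomorph.addRight (-(v i))) ⁻¹' xEv s (s / 4) with hEv
  have hX : ((1 : ℝ) / 2) ^ 17 ≤ μ.real (xEv s (s / 4)) := hc₁ ▸ measureReal_xEv_ge hB hW hs hA.ge
  have hEvμ : ∀ i, μ.real (Ev i) = μ.real (xEv s (s / 4)) := fun i => by
    simp only [hEv, measureReal_def, hμ]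
    rw [measure_preimage_pairImage_addRight hB hW]
  have hEm : ∀ i, MeasurableSet (Ev i) := fun i => measurableSet_preimage_pairImage (measurableSet_xEv _ _) _
  have hEg : ∀ i, IsGoodIncreasing (Ev i) := fun i => (isGoodIncreasing_xEv _ _).preimage_pairImage _
  -- FKG
  have hFKG := finset_prod_measureReal_le_of_isGoodIncreasing hB hW (Finset.range 4) (Ev := Ev)
    (fun i _ => hEg i) (fun i _ => hEm i)
  have hprod : ((1 : ℝ) / 2) ^ 68 ≤ ∏ i ∈ Finset.range 4, μ.real (Ev i) := by
    rw [Finset.prod_congr rfl fun i _ => hEvμ i, Finset.prod_const, Finset.card_range,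
      show ((1 : ℝ) / 2) ^ 68 = (((1 : ℝ) / 2) ^ 17) ^ 4 by ring]
    exact pow_le_pow_left₀ (by positivity) hX 4
  -- the copies in coordinates
  have e0 : v 0 = ⟨s / 2, s / 4⟩ := by simp [hv]
  have e1 : v 1 = ⟨s / 2, s / 4 + s / 2⟩ := by simp [hv]
  have e2 : v 2 = ⟨s / 2, s / 4 + s / 2 + s / 2⟩ := by
    simp only [hv, Nat.cast_ofNat, Complex.mk.injEq, true_and]; ring
  have e3 : v 3 = ⟨s / 2, s / 4 + s / 2 + s / 2 + s / 2⟩ := by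
    simp only [hv, Nat.cast_ofNat, Complex.mk.injEq, true_and]; ring
  -- gluing
  have hsub : (⋂ i ∈ Finset.range 4, Ev i) ⊆ tbCross 0 s 0 (2 * s) := by
    intro ω hω
    simp only [mem_iInter, Finset.mem_range] at hω
    have h0 : pairImage (Homeomorph.addRight (-(⟨s / 2, s / 4⟩ : ℂ))) ω ∈ xEv s (s / 4) := by
      have := hω 0 (by norm_num); rwa [hEv, mem_preimage, e0] at this
    have h1 : pairImage (Homeomorph.addRight (-(⟨s / 2, s / 4 + s / 2⟩ : ℂ))) ω ∈ xEv s (s / 4) := by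
      have := hω 1 (by norm_num); rwa [hEv, mem_preimage, e1] at this
    have h2 : pairImage (Homeomorph.addRight (-(⟨s / 2, s / 4 + s / 2 + s / 2⟩ : ℂ))) ω ∈ xEv s (s / 4) := by
      have := hω 2 (by norm_num); rwa [hEv, mem_preimage, e2] at this
    have h3 : pairImage (Homeomorph.addRight (-(⟨s / 2, s / 4 + s / 2 + s / 2 + s / 2⟩ : ℂ))) ω ∈
        xEv s (s / 4) := by
      have := hω 3 (by norm_num); rwa [hEv, mem_preimage, e3] at this
    obtain ⟨C₀, hC₀, hC₀c, hC₀p, hr₀, hlh₀, ⟨ll₀, hll₀, -, -, hll₀'⟩⟩ := exists_legs_caseA hs h0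
    obtain ⟨C₁, hC₁, hC₁c, hC₁p, hr₁, hlh₁, hll₁⟩ := exists_legs_caseA hs h1
    obtain ⟨C₂, hC₂, hC₂c, hC₂p, hr₂, hlh₂, hll₂⟩ := exists_legs_caseA hs h2
    obtain ⟨C₃, hC₃, hC₃c, hC₃p, -, hlh₃, hll₃⟩ := exists_legs_caseA hs h3
    obtain ⟨w₁, hw₁, hw₁'⟩ := legs_meet_caseA hs hC₀ hC₀c hC₀p hr₀ hlh₀ hC₁ hC₁c hC₁p hlh₁ hll₁
    obtain ⟨w₂, hw₂, hw₂'⟩ := legs_meet_caseA hs hC₁ hC₁c hC₁p hr₁ hlh₁ hC₂ hC₂c hC₂p hlh₂ hll₂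
    obtain ⟨w₃, hw₃, hw₃'⟩ := legs_meet_caseA hs hC₂ hC₂c hC₂p hr₂ hlh₂ hC₃ hC₃c hC₃p hlh₃ hll₃
    obtain ⟨lh₃, hlh₃m, -, hlh₃', -⟩ := hlh₃
    set U : Set ℂ := ((C₀ ∪ C₁) ∪ C₂) ∪ C₃ with hU
    have hUc : IsCompact U := ((hC₀c.union hC₁c).union hC₂c).union hC₃c
    have hUp : IsPreconnected U :=
      ((hC₀p.union w₁ hw₁ hw₁' hC₁p).union w₂ (Or.inr hw₂) hw₂' hC₂p).union w₃ (Or.inr hw₃) hw₃' hC₃p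
    have hUblack : U ⊆ blackRegion ((ω.1 : PointConfig ℂ) : Set ℂ) ((ω.2 : PointConfig ℂ) : Set ℂ) ∩
        {w | 0 ≤ w.re ∧ w.re ≤ s} := by
      rintro w (((hw | hw) | hw) | hw)
      · exact ⟨(hC₀ hw).1, (mem_cRect.1 (hC₀ hw).2).1⟩
      · exact ⟨(hC₁ hw).1, (mem_cRect.1 (hC₁ hw).2).1⟩
      · exact ⟨(hC₂ hw).1, (mem_cRect.1 (hC₂ hw).2).1⟩
      · exact ⟨(hC₃ hw).1, (mem_cRect.1 (hC₃ hw).2).1⟩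
    obtain ⟨K', hK'U, hK'c, hK'p, hK'band, hK'lo, hK'hi⟩ := exists_subcontinuum_between_hlines (c := 0)
      (d := 2 * s) (by linarith) hUc hUp ⟨ll₀, Or.inl (Or.inl (Or.inl hll₀)), by linarith⟩
      ⟨lh₃, Or.inr hlh₃m, by linarith⟩
    refine ⟨K', fun w hw => ⟨(hUblack (hK'U hw)).1, mem_cRect.2 ⟨(hUblack (hK'U hw)).2, hK'band w hw⟩⟩,
      hK'c, hK'p, hK'lo, hK'hi⟩
  -- conclusion
  have hmono : μ.real (⋂ i ∈ Finset.range 4, Ev i) ≤ μ.real (tbCross 0 s 0 (2 * s)) :=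
    measureReal_mono hsub (measure_ne_top _ _)
  have htb : μ.real (tbCross 0 s 0 (2 * s)) = μ.real (lrCross 0 (2 * s) 0 s) := by
    rw [measureReal_def, measureReal_def, measure_tbCross_eq hB hW]
  linarith

end CaseA

/-! ### Lemma 2.2, case `α_s < s/4`, `α_s ≤ 2α_{2s/3}` -/

section CaseB

variable {PB PW : Measure (PointConfig ℂ)} {s : ℝ}

set_option maxHeartbeats 400000 in -- buildfix 2026-08-19: the proof sits at the default budget (~200k measured)
/-- **Lemma 2.2, main case: `f_s(4/3) ≥ c₁ (3/16)² ≥ 2⁻²²`.**  With `α' = α_{2s/3}`, the four-legged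
continuum of `X_{2s/3}(α')` in `B_{s/3}` is met (gate lemma, on its right and on its left) by the
continua of `E = H_s(0, 2α') + (-s/6, -α')` and of its mirror image `E'`; together they cross the
`4s/3 × s` rectangle `R ∪ R'`. [cite: Tassion2016, Lemma 2.2 (Fig. 5)] -/
theorem measureReal_f43_ge_of_alphaS_le (hB : IsPoissonPointProcess (volume : Measure ℂ) PB)
    (hW : IsPoissonPointProcess (volume : Measure ℂ) PW) (hs : 0 < s)
    (hlt : alphaS (PB.prod PW) s < s / 4)
    (hle : alphaS (PB.prod PW) s ≤ 2 * alphaS (PB.prod PW) (2 * s / 3)) :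
    ((1 : ℝ) / 2) ^ 22 ≤ (PB.prod PW).real (lrCross 0 ((1 + 1 / 3) * s) 0 s) := by
  haveI := hB.isProbabilityMeasure; haveI := hW.isProbabilityMeasure
  set μ := PB.prod PW with hμ
  have hc₁ : ((1 : ℝ) / 2) ^ 17 = (1 / 16) ^ 4 * (1 / 2) := by norm_num
  set s' : ℝ := 2 * s / 3 with hs'
  have hs'0 : 0 < s' := by rw [hs']; positivity
  set α' : ℝ := alphaS μ s' with hα'
  have hα'0 : 0 ≤ α' := alphaS_nonneg hB hW hs'0
  have hα's : α' ≤ s / 6 := by have := alphaS_le hB hW hs'0; rw [hs'] at this; linarith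
  -- the three events
  set X : Set (PointConfig ℂ × PointConfig ℂ) := xEv s' α' with hX
  set v : ℂ := ⟨-(s / 6), -α'⟩ with hv
  set E : Set (PointConfig ℂ × PointConfig ℂ) := pairImage (Homeomorph.addRight (-v)) ⁻¹' hEv s 0 (2 * α') with hE
  set E' : Set (PointConfig ℂ × PointConfig ℂ) := pairImage negConjLIE.toHomeomorph ⁻¹' E with hE'
  have hXμ : ((1 : ℝ) / 2) ^ 17 ≤ μ.real X := hc₁ ▸ measureReal_xEv_ge hB hW hs'0 le_rfl
  have hEμ : 3 / 16 ≤ μ.real E := by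
    have h := measureReal_hEv_zero_ge hB hW hs hlt hle
    simp only [hE, measureReal_def, hμ] at h ⊢
    rwa [measure_preimage_pairImage_addRight hB hW]
  have hE'μ : 3 / 16 ≤ μ.real E' := by
    simp only [hE', measureReal_def, hμ]
    rw [measure_preimage_pairImage_linearIsometryEquiv hB hW]
    exact hEμ
  have mX : MeasurableSet X := measurableSet_xEv _ _
  have mE : MeasurableSet E := measurableSet_preimage_pairImage (measurableSet_hEv _ _ _) _
  have mE' : MeasurableSet E' := measurableSet_preimage_pairImage mE _
  have gX : IsGoodIncreasing X := isGoodIncreasing_xEv _ _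
  have gE : IsGoodIncreasing E := (isGoodIncreasing_hEv _ _ _).preimage_pairImage _
  have gE' : IsGoodIncreasing E' := gE.preimage_pairImage _
  have f1 := measureReal_mul_le_of_isGoodIncreasing hB hW gX gE mX mE
  have f2 := measureReal_mul_le_of_isGoodIncreasing hB hW (gX.inter gE) gE' (mX.inter mE) mE'
  have hprod : ((1 : ℝ) / 2) ^ 22 ≤ μ.real (X ∩ E ∩ E') := by
    have h17 : (0 : ℝ) ≤ ((1 : ℝ) / 2) ^ 17 := by positivity
    have e1 : ((1 : ℝ) / 2) ^ 17 * (3 / 16) ≤ μ.real (X ∩ E) := by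
      nlinarith [mul_le_mul hXμ hEμ (by norm_num) measureReal_nonneg]
    have e2 : ((1 : ℝ) / 2) ^ 17 * (3 / 16) * (3 / 16) ≤ μ.real (X ∩ E ∩ E') := by
      nlinarith [mul_le_mul e1 hE'μ (by norm_num) measureReal_nonneg]
    have e3 : ((1 : ℝ) / 2) ^ 22 ≤ ((1 : ℝ) / 2) ^ 17 * (3 / 16) * (3 / 16) := by
      rw [show ((1 : ℝ) / 2) ^ 22 = ((1 : ℝ) / 2) ^ 17 * (1 / 32) by norm_num]
      nlinarith
    exact e3.trans e2
  -- gluing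
  have hsub : X ∩ E ∩ E' ⊆ lrCross (-(2 * s / 3)) (2 * s / 3) (-(s / 2) - α') (s / 2 - α') := by
    rintro ω ⟨⟨hωX, hωE⟩, hωE'⟩
    rw [hE', mem_preimage, hE] at hωE'
    rw [hE, mem_preimage] at hωE
    rw [hX] at hωX
    obtain ⟨C, hC, hCc, hCp, ⟨rh, hrh, hrh1, hrh2, hrh3⟩, ⟨rl, hrl, hrl1, hrl2, hrl3⟩,
      ⟨lh, hlh, hlh1, hlh2, hlh3⟩, ⟨ll, hll, hll1, hll2, hll3⟩⟩ := exists_fourLegs_of_mem_xEv hs'0 hωX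
    obtain ⟨K, hK, hKc, hKp, ⟨a, ha, hare⟩, ⟨p, hp, hpre, hp1, hp2⟩⟩ := exists_continuum_of_mem_preimage_hEv hωE
    obtain ⟨K', hK', hK'c, hK'p, ⟨a', ha', ha're⟩, ⟨p', hp', hp're, hp'1, hp'2⟩⟩ :=
      exists_continuum_of_mem_preimage_negConj_hEv hωE'
    have hvre : v.re = -(s / 6) := rfl
    have hvim : v.im = -α' := rfl
    simp only [hvre, hvim, add_zero] at hK hK' hare hpre hp1 hp2 ha're hp're hp'1 hp'2
    have hCR : ∀ w ∈ C, (-(s / 3) ≤ w.re ∧ w.re ≤ s / 3) ∧ -(s / 3) ≤ w.im ∧ w.im ≤ s / 3 := by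
      intro w hw
      have h := mem_sqr.1 (hC hw).2
      rw [hs'] at h
      exact ⟨⟨by linarith [h.1.1], by linarith [h.1.2]⟩, by linarith [h.2.1], by linarith [h.2.2]⟩
    -- right gate: `K` (from the left side of `R` to `p`) meets `C`
    have hKC : (K ∩ C).Nonempty := by
      refine inter_nonempty_of_gate_right (a := -(s / 6) - s / 2) (b := -(s / 6) + s / 2)
        (c := -α' - s / 2) (d := -α' + s / 2) (y := p.im) (by linarith) (by linarith) hKc hKp
        (fun w hw => (hK hw).2) ⟨a, ha, hare⟩ ⟨p, hp, hpre, rfl⟩ hCc hCp ?_ ?_ ?_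
      · intro w hw
        have h := hCR w hw
        exact mem_cRect.2 ⟨⟨by linarith [h.1.1], by linarith [h.1.2]⟩, by linarith [h.2.1], by linarith [h.2.2]⟩
      · exact ⟨rl, hrl, by rw [hrl1, hs']; ring, by linarith⟩
      · exact ⟨rh, hrh, by rw [hrh1, hs']; ring, by linarith⟩
    -- left gate: `K'` (from the right side of `R'` to `p'`) meets `C`
    have hK'C : (K' ∩ C).Nonempty := by
      refine inter_nonempty_of_gate_left (a := -(-(s / 6) + s / 2)) (b := -(-(s / 6) - s / 2))
        (c := -α' - s / 2) (d := -α' + s / 2) (y := p'.im) (by linarith) (by linarith) hK'c hK'p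
        (fun w hw => (hK' hw).2) ⟨a', ha', ha're⟩ ⟨p', hp', hp're, rfl⟩ hCc hCp ?_ ?_ ?_
      · intro w hw
        have h := hCR w hw
        exact mem_cRect.2 ⟨⟨by linarith [h.1.1], by linarith [h.1.2]⟩, by linarith [h.2.1], by linarith [h.2.2]⟩
      · exact ⟨ll, hll, by rw [hll1, hs']; ring, by linarith⟩
      · exact ⟨lh, hlh, by rw [hlh1, hs']; ring, by linarith⟩
    obtain ⟨w₁, hw₁K, hw₁C⟩ := hKC
    obtain ⟨w₂, hw₂K', hw₂C⟩ := hK'C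
    refine ⟨(K ∪ C) ∪ K', ?_, (hKc.union hCc).union hK'c,
      (hKp.union w₁ hw₁K hw₁C hCp).union w₂ (Or.inr hw₂C) hw₂K' hK'p,
      ⟨a, Or.inl (Or.inl ha), by show a.re = _; rw [hare]; ring⟩,
      ⟨a', Or.inr ha', by show a'.re = _; rw [ha're]; ring⟩⟩
    rintro w ((hw | hw) | hw)
    · refine ⟨(hK hw).1, ?_⟩
      have h := mem_cRect.1 (hK hw).2
      exact mem_cRect.2 ⟨⟨by linarith [h.1.1], by linarith [h.1.2]⟩, by linarith [h.2.1], by linarith [h.2.2]⟩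
    · refine ⟨(hC hw).1, ?_⟩
      have h := hCR w hw
      exact mem_cRect.2 ⟨⟨by linarith [h.1.1], by linarith [h.1.2]⟩, by linarith [h.2.1], by linarith [h.2.2]⟩
    · refine ⟨(hK' hw).1, ?_⟩
      have h := mem_cRect.1 (hK' hw).2
      exact mem_cRect.2 ⟨⟨by linarith [h.1.1], by linarith [h.1.2]⟩, by linarith [h.2.1], by linarith [h.2.2]⟩
  have hmono : μ.real (X ∩ E ∩ E') ≤ μ.real (lrCross (-(2 * s / 3)) (2 * s / 3) (-(s / 2) - α') (s / 2 - α')) :=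
    measureReal_mono hsub (measure_ne_top _ _)
  have hshape : μ.real (lrCross (-(2 * s / 3)) (2 * s / 3) (-(s / 2) - α') (s / 2 - α')) =
      μ.real (lrCross 0 ((1 + 1 / 3) * s) 0 s) := by
    rw [measureReal_def, measureReal_def]
    exact congrArg ENNReal.toReal (measure_lrCross_eq_of_shape hB hW (by ring) (by ring))
  linarith

end CaseB

/-! ### Lemma 2.2: good scales -/

section Good

variable {PB PW : Measure (PointConfig ℂ)} {s : ℝ}

/-- **Lemma 2.2 (RSW at good scales): `f_s(4) ≥ 2⁻²⁰⁶`** at every GOOD scale `s > 0`, i.e. when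
`α_s = s/4` or `α_s ≤ 2 α_{2s/3}` (Tassion's condition (12), non-strict): chain `f_s(2) ≥ 2⁻⁶⁸`
(`κ = 1`, three pieces) or `f_s(4/3) ≥ 2⁻²²` (`κ = 1/3`, nine pieces) with Cor. 1.3 (2) and
`f_s(1) ≥ 1/2`. [cite: Tassion2016, Lemma 2.2 and eq. (12)] -/
theorem measureReal_f4_ge_of_good (hB : IsPoissonPointProcess (volume : Measure ℂ) PB)
    (hW : IsPoissonPointProcess (volume : Measure ℂ) PW) (hs : 0 < s)
    (hgood : alphaS (PB.prod PW) s = s / 4 ∨ alphaS (PB.prod PW) s ≤ 2 * alphaS (PB.prod PW) (2 * s / 3)) :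
    ((1 : ℝ) / 2) ^ 206 ≤ (PB.prod PW).real (lrCross 0 (4 * s) 0 s) := by
  haveI := hB.isProbabilityMeasure; haveI := hW.isProbabilityMeasure
  set μ := PB.prod PW with hμ
  have hf1 : 1 / 2 ≤ μ.real (lrCross 0 s 0 s) :=
    half_le_measureReal_lrCross_square hB hW hs (by ring)
  by_cases hA : alphaS μ s = s / 4
  · -- case A: from `f_s(2)`
    have hf2 := measureReal_f2_ge_of_alphaS_eq hB hW hs hA
    have hch := measureReal_lrCross_chain hB hW hs one_pos 2
    have e1 : (1 + 1 : ℝ) * s = 2 * s := by ring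
    have e2 : (1 + ((2 + 1 : ℕ) : ℝ) * 1) * s = 4 * s := by push_cast; ring
    rw [e1, e2] at hch
    refine le_trans ?_ hch
    calc ((1 : ℝ) / 2) ^ 206 = (((1 : ℝ) / 2) ^ 68) ^ (2 + 1) * (1 / 2) ^ 2 := by ring
      _ ≤ μ.real (lrCross 0 (2 * s) 0 s) ^ (2 + 1) * μ.real (lrCross 0 s 0 s) ^ 2 := by
          gcongr
  · -- case B: from `f_s(4/3)`
    have hlt : alphaS μ s < s / 4 := lt_of_le_of_ne (alphaS_le hB hW hs) hA
    have hle : alphaS μ s ≤ 2 * alphaS μ (2 * s / 3) := hgood.resolve_left hA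
    have hf43 := measureReal_f43_ge_of_alphaS_le hB hW hs hlt hle
    have hch := measureReal_lrCross_chain hB hW hs (by norm_num : (0 : ℝ) < 1 / 3) 8
    have e2 : (1 + ((8 + 1 : ℕ) : ℝ) * (1 / 3)) * s = 4 * s := by push_cast; ring
    rw [e2] at hch
    refine le_trans ?_ hch
    calc ((1 : ℝ) / 2) ^ 206 = (((1 : ℝ) / 2) ^ 22) ^ (8 + 1) * (1 / 2) ^ 8 := by ring
      _ ≤ μ.real (lrCross 0 ((1 + 1 / 3) * s) 0 s) ^ (8 + 1) * μ.real (lrCross 0 s 0 s) ^ 8 := by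
          gcongr

/-- **`P[A_s] ≥ 2⁻⁸²⁴` at good scales** (Cor. 1.3 (3)). [cite: Tassion2016, Lemma 2.2 with Cor 1.3 (3)] -/
theorem measureReal_annEv_ge_of_good (hB : IsPoissonPointProcess (volume : Measure ℂ) PB)
    (hW : IsPoissonPointProcess (volume : Measure ℂ) PW) (hs : 0 < s)
    (hgood : alphaS (PB.prod PW) s = s / 4 ∨ alphaS (PB.prod PW) s ≤ 2 * alphaS (PB.prod PW) (2 * s / 3)) :
    ((1 : ℝ) / 2) ^ 824 ≤ (PB.prod PW).real (annEv s) := by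
  rw [show ((1 : ℝ) / 2) ^ 824 = (((1 : ℝ) / 2) ^ 206) ^ 4 by rw [← pow_mul]]
  exact (pow_le_pow_left₀ (by positivity) (measureReal_f4_ge_of_good hB hW hs hgood) 4).trans
    (measureReal_annEv_ge hB hW)

end Good


/-! ### Locality of the annulus event -/

section Locality

variable {z : ℂ} {u : ℝ}

/-- **Locality of weak colours** (two-colour form of Tassion's Lemma 1.1): on `nucleiNear z u`, the
weak colour of a point `w` with `u ≤ |w - z| ≤ 4u` is decided by the nuclei in the locality region.
[cite: Tassion2016, Lemma 1.1] -/
theorem mem_blackRegion_iff_restrictPair (hu : 0 < u) {ω : (PointConfig ℂ × PointConfig ℂ)} (hω : ω ∈ nucleiNear z u) {w : ℂ}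
    (h1 : u ≤ dist w z) (h2 : dist w z ≤ 4 * u) :
    w ∈ blackRegion ((ω.1 : PointConfig ℂ) : Set ℂ) ((ω.2 : PointConfig ℂ) : Set ℂ) ↔
      w ∈ blackRegion (((restrictPair (localityRegion z u) ω).1 : PointConfig ℂ) : Set ℂ)
        (((restrictPair (localityRegion z u) ω).2 : PointConfig ℂ) : Set ℂ) := by
  obtain ⟨p, hp, hpw⟩ := exists_gridPt_near hu h1 h2
  have hballD : ball w (u / 4) ⊆ localityRegion z u := by
    intro x hx
    rw [mem_ball] at hx
    constructor
    · rw [mem_ball]; linarith [dist_triangle x w z]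
    · rw [mem_closedBall, not_le]
      have := dist_triangle w x z
      rw [dist_comm w x] at this
      linarith
  have hsub : ball (gridPt z u p) (u / 8) ⊆ ball w (u / 4) := by
    intro x hx
    rw [mem_ball] at hx ⊢
    rw [dist_comm] at hpw
    linarith [dist_triangle x (gridPt z u p) w]
  obtain ⟨hB, hW⟩ := hω p hp
  rw [PointConfig.count_ne_zero_iff] at hB hW
  have hB' : (((ω.1 : PointConfig ℂ) : Set ℂ) ∩ ball w (u / 4)).Nonempty :=
    hB.mono (inter_subset_inter_right _ hsub)
  have hW' : (((ω.2 : PointConfig ℂ) : Set ℂ) ∩ ball w (u / 4)).Nonempty :=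
    hW.mono (inter_subset_inter_right _ hsub)
  have eB := infDist_eq_infDist_inter hballD hB'
  have eW := infDist_eq_infDist_inter hballD hW'
  simp only [mem_blackRegion, restrictPair, coe_restrict]
  rw [← eB, ← eW]

/-- Crossing events of a set inside the annulus `u ≤ |· - z| ≤ 4u` are, on the locality event,
events of the restricted configuration. [cite: Tassion2016, Lemma 1.1] -/
theorem mem_blackCross_iff_restrictPair (hu : 0 < u) {ω : (PointConfig ℂ × PointConfig ℂ)} (hω : ω ∈ nucleiNear z u)
    {R A A' : Set ℂ} (hR : ∀ w ∈ R, u ≤ dist w z ∧ dist w z ≤ 4 * u) :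
    ω ∈ blackCross R A A' ↔ restrictPair (localityRegion z u) ω ∈ blackCross R A A' := by
  have key : blackRegion ((ω.1 : PointConfig ℂ) : Set ℂ) ((ω.2 : PointConfig ℂ) : Set ℂ) ∩ R =
      blackRegion (((restrictPair (localityRegion z u) ω).1 : PointConfig ℂ) : Set ℂ)
        (((restrictPair (localityRegion z u) ω).2 : PointConfig ℂ) : Set ℂ) ∩ R := by
    ext w
    constructor
    · rintro ⟨hw, hwR⟩
      exact ⟨(mem_blackRegion_iff_restrictPair hu hω (hR w hwR).1 (hR w hwR).2).1 hw, hwR⟩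
    · rintro ⟨hw, hwR⟩
      exact ⟨(mem_blackRegion_iff_restrictPair hu hω (hR w hwR).1 (hR w hwR).2).2 hw, hwR⟩
  simp only [blackCross, mem_setOf_eq]
  rw [key]

variable {s : ℝ}

/-- The four rectangles of the annulus event lie in the round annulus
`3s/4 ≤ |w| ≤ 3s` of the scale `u = 3s/4`. [folklore] -/
theorem annulus_rect_bounds (hs : 0 < s) {w : ℂ} (hre : -(2 * s) ≤ w.re ∧ w.re ≤ 2 * s)
    (him : -(2 * s) ≤ w.im ∧ w.im ≤ 2 * s) (hfar : s ≤ |w.re| ∨ s ≤ |w.im|) :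
    3 * s / 4 ≤ dist w 0 ∧ dist w 0 ≤ 4 * (3 * s / 4) := by
  rw [dist_zero_right]
  have hn : ‖w‖ ^ 2 = w.re ^ 2 + w.im ^ 2 := by rw [Complex.sq_norm, Complex.normSq_apply]; ring
  have hre2 : w.re ^ 2 ≤ (2 * s) ^ 2 := by nlinarith [hre.1, hre.2, abs_le.2 hre]
  have him2 : w.im ^ 2 ≤ (2 * s) ^ 2 := by nlinarith [him.1, him.2, abs_le.2 him]
  have hnn : 0 ≤ ‖w‖ := norm_nonneg w
  constructor
  · have hlow : s ^ 2 ≤ ‖w‖ ^ 2 := by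
      rcases hfar with h | h
      · have : s ^ 2 ≤ |w.re| ^ 2 := by nlinarith [abs_nonneg w.re]
        rw [sq_abs] at this; nlinarith [sq_nonneg w.im]
      · have : s ^ 2 ≤ |w.im| ^ 2 := by nlinarith [abs_nonneg w.im]
        rw [sq_abs] at this; nlinarith [sq_nonneg w.re]
    nlinarith
  · nlinarith

/-- **Locality of the annulus event** (with the locality event of its scale, `u = 3s/4`): the event
`A_s ∩ nucleiNear 0 (3s/4)` is an event of the configuration restricted to `localityRegion 0 (3s/4)`.
[cite: Tassion2016, Lemma 1.1 and proof of Lemma 3.2] -/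
theorem preimage_restrictPair_annLoc (hs : 0 < s) :
    restrictPair (localityRegion 0 (3 * s / 4)) ⁻¹' (annEv s ∩ nucleiNear 0 (3 * s / 4)) =
      annEv s ∩ nucleiNear 0 (3 * s / 4) := by
  have hu : 0 < 3 * s / 4 := by positivity
  ext ω
  simp only [mem_preimage, mem_inter_iff]
  rw [← mem_nucleiNear_iff_restrictPair hu ω]
  by_cases hω : ω ∈ nucleiNear 0 (3 * s / 4)
  · simp only [hω, and_true, annEv, mem_inter_iff, lrCross, tbCross]
    have hb : ∀ {a b c d : ℝ}, -(2 * s) ≤ a → b ≤ 2 * s → -(2 * s) ≤ c → d ≤ 2 * s →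
        (s ≤ a ∨ b ≤ -s ∨ s ≤ c ∨ d ≤ -s) →
        ∀ w ∈ cRect a b c d, 3 * s / 4 ≤ dist w 0 ∧ dist w 0 ≤ 4 * (3 * s / 4) := by
      intro a b c d ha hb hc hd hside w hw
      have h := mem_cRect.1 hw
      refine annulus_rect_bounds hs ⟨by linarith [h.1.1], by linarith [h.1.2]⟩
        ⟨by linarith [h.2.1], by linarith [h.2.2]⟩ ?_
      rcases hside with h' | h' | h' | h'
      · left; rw [abs_of_nonneg (by linarith [h.1.1])]; linarith [h.1.1]
      · left; rw [abs_of_nonpos (by linarith [h.1.2])]; linarith [h.1.2]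
      · right; rw [abs_of_nonneg (by linarith [h.2.1])]; linarith [h.2.1]
      · right; rw [abs_of_nonpos (by linarith [h.2.2])]; linarith [h.2.2]
    rw [← mem_blackCross_iff_restrictPair hu hω (hb (a := -(2 * s)) (b := 2 * s) (c := s) (d := 2 * s)
        le_rfl le_rfl (by linarith) le_rfl (Or.inr (Or.inr (Or.inl le_rfl)))),
      ← mem_blackCross_iff_restrictPair hu hω (hb (a := -(2 * s)) (b := 2 * s) (c := -(2 * s)) (d := -s)
        le_rfl le_rfl le_rfl (by linarith) (Or.inr (Or.inr (Or.inr le_rfl)))),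
      ← mem_blackCross_iff_restrictPair hu hω (hb (a := -(2 * s)) (b := -s) (c := -(2 * s)) (d := 2 * s)
        le_rfl (by linarith) le_rfl le_rfl (Or.inr (Or.inl le_rfl))),
      ← mem_blackCross_iff_restrictPair hu hω (hb (a := s) (b := 2 * s) (c := -(2 * s)) (d := 2 * s)
        (by linarith) le_rfl le_rfl le_rfl (Or.inl le_rfl))]
  · simp [hω]

end Locality

/-! ### Lemma 3.1 -/

section L31

variable {PB PW : Measure (PointConfig ℂ)} {s t : ℝ}

/-- **Lemma 3.1: `f_t(2) ≥ (3/16)² P[A_s]`** for `t ≥ 4s` and `α_t < s`.  The crossings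
`E₁ = H_t(0, s) + (-t/2, 0)` (from the left side of `[-t, 0] × [-t/2, t/2]` to `{0} × [0, s]`) and
its mirror image `E₂` meet the hooks of `A_s` (gate lemma), which are joined through the top
crossing of `A_s`. [cite: Tassion2016, Lemma 3.1] -/
theorem measureReal_f2_ge_of_annEv (hB : IsPoissonPointProcess (volume : Measure ℂ) PB)
    (hW : IsPoissonPointProcess (volume : Measure ℂ) PW) (hs : 0 < s) (hts : 4 * s ≤ t)
    (hαt : alphaS (PB.prod PW) t < s) :
    (3 / 16) ^ 2 * (PB.prod PW).real (annEv s) ≤ (PB.prod PW).real (lrCross 0 (2 * t) 0 t) := by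
  haveI := hB.isProbabilityMeasure; haveI := hW.isProbabilityMeasure
  set μ := PB.prod PW with hμ
  have ht : 0 < t := by linarith
  have hlt : alphaS μ t < t / 4 := by linarith
  set v : ℂ := ⟨-(t / 2), 0⟩ with hv
  set E₁ : Set (PointConfig ℂ × PointConfig ℂ) := pairImage (Homeomorph.addRight (-v)) ⁻¹' hEv t 0 s with hE₁
  set E₂ : Set (PointConfig ℂ × PointConfig ℂ) := pairImage negConjLIE.toHomeomorph ⁻¹' E₁ with hE₂
  have hE₁μ : 3 / 16 ≤ μ.real E₁ := by
    have h := measureReal_hEv_zero_ge hB hW ht hlt hαt.le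
    simp only [hE₁, measureReal_def, hμ] at h ⊢
    rwa [measure_preimage_pairImage_addRight hB hW]
  have hE₂μ : 3 / 16 ≤ μ.real E₂ := by
    simp only [hE₂, measureReal_def, hμ]
    rw [measure_preimage_pairImage_linearIsometryEquiv hB hW]
    exact hE₁μ
  have mA := measurableSet_annEv s
  have mE₁ : MeasurableSet E₁ := measurableSet_preimage_pairImage (measurableSet_hEv _ _ _) _
  have mE₂ : MeasurableSet E₂ := measurableSet_preimage_pairImage mE₁ _
  have gA := isGoodIncreasing_annEv s
  have gE₁ : IsGoodIncreasing E₁ := (isGoodIncreasing_hEv _ _ _).preimage_pairImage _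
  have gE₂ : IsGoodIncreasing E₂ := gE₁.preimage_pairImage _
  have f1 := measureReal_mul_le_of_isGoodIncreasing hB hW gA gE₁ mA mE₁
  have f2 := measureReal_mul_le_of_isGoodIncreasing hB hW (gA.inter gE₁) gE₂ (mA.inter mE₁) mE₂
  have hprod : (3 / 16) ^ 2 * μ.real (annEv s) ≤ μ.real (annEv s ∩ E₁ ∩ E₂) := by
    have hA0 : 0 ≤ μ.real (annEv s) := measureReal_nonneg
    have e1 : μ.real (annEv s) * (3 / 16) ≤ μ.real (annEv s ∩ E₁) := by
      nlinarith [mul_le_mul_of_nonneg_left hE₁μ hA0]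
    nlinarith [mul_le_mul e1 hE₂μ (by norm_num) measureReal_nonneg]
  have hsub : annEv s ∩ E₁ ∩ E₂ ⊆ lrCross (-t) t (-(t / 2)) (t / 2) := by
    rintro ω ⟨⟨hωA, hω₁⟩, hω₂⟩
    rw [hE₂, mem_preimage, hE₁] at hω₂
    rw [hE₁, mem_preimage] at hω₁
    obtain ⟨U_L, U_R, K_T, ⟨hUL, hULc, hULp, ⟨qh, hqh, hqhre, hqhim⟩, ⟨ql, hql, hqlre, hqlim⟩⟩,
      ⟨hUR, hURc, hURp, ⟨qh', hqh', hqh're, hqh'im⟩, ⟨ql', hql', hql're, hql'im⟩⟩,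
      ⟨hKT, hKTc, hKTp, -, -⟩, ⟨m₁, hm₁U, hm₁T⟩, ⟨m₂, hm₂U, hm₂T⟩⟩ := exists_hooks_of_mem_annEv hs hωA
    obtain ⟨K₁, hK₁, hK₁c, hK₁p, ⟨a₁, ha₁, ha₁re⟩, ⟨p₁, hp₁, hp₁re, hp₁1, hp₁2⟩⟩ :=
      exists_continuum_of_mem_preimage_hEv hω₁
    obtain ⟨K₂, hK₂, hK₂c, hK₂p, ⟨a₂, ha₂, ha₂re⟩, ⟨p₂, hp₂, hp₂re, hp₂1, hp₂2⟩⟩ :=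
      exists_continuum_of_mem_preimage_negConj_hEv hω₂
    simp only [hv] at hK₁ hK₂ ha₁re hp₁re hp₁1 hp₁2 ha₂re hp₂re hp₂1 hp₂2
    -- gate on the right side of `[-t, 0] × [-t/2, t/2]`
    have g₁ : (K₁ ∩ U_L).Nonempty := by
      refine inter_nonempty_of_gate_right (a := -(t / 2) - t / 2) (b := -(t / 2) + t / 2)
        (c := 0 - t / 2) (d := 0 + t / 2) (y := p₁.im) (by linarith) (by linarith) hK₁c hK₁p
        (fun w hw => (hK₁ hw).2) ⟨a₁, ha₁, ha₁re⟩ ⟨p₁, hp₁, hp₁re, rfl⟩ hULc hULp ?_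
        ⟨ql, hql, by rw [hqlre]; ring, by linarith⟩ ⟨qh, hqh, by rw [hqhre]; ring, by linarith⟩
      intro w hw
      have h := mem_cRect.1 (hUL hw).2
      exact mem_cRect.2 ⟨⟨by linarith [h.1.1], by linarith [h.1.2]⟩, by linarith [h.2.1], by linarith [h.2.2]⟩
    -- gate on the left side of `[0, t] × [-t/2, t/2]`
    have g₂ : (K₂ ∩ U_R).Nonempty := by
      refine inter_nonempty_of_gate_left (a := -(-(t / 2) + t / 2)) (b := -(-(t / 2) - t / 2))
        (c := 0 - t / 2) (d := 0 + t / 2) (y := p₂.im) (by linarith) (by linarith) hK₂c hK₂p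
        (fun w hw => (hK₂ hw).2) ⟨a₂, ha₂, ha₂re⟩ ⟨p₂, hp₂, hp₂re, rfl⟩ hURc hURp ?_
        ⟨ql', hql', by rw [hql're]; ring, by linarith⟩ ⟨qh', hqh', by rw [hqh're]; ring, by linarith⟩
      intro w hw
      have h := mem_cRect.1 (hUR hw).2
      exact mem_cRect.2 ⟨⟨by linarith [h.1.1], by linarith [h.1.2]⟩, by linarith [h.2.1], by linarith [h.2.2]⟩
    obtain ⟨w₁, hw₁K, hw₁U⟩ := g₁
    obtain ⟨w₂, hw₂K, hw₂U⟩ := g₂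
    refine ⟨(((K₁ ∪ U_L) ∪ K_T) ∪ U_R) ∪ K₂, ?_, (((hK₁c.union hULc).union hKTc).union hURc).union hK₂c,
      ?_, ⟨a₁, by simp [ha₁], by show a₁.re = _; rw [ha₁re]; ring⟩,
      ⟨a₂, Or.inr ha₂, by show a₂.re = _; rw [ha₂re]; ring⟩⟩
    · have hrect : ∀ {w : ℂ} {a b c d : ℝ}, w ∈ cRect a b c d → -t ≤ a → b ≤ t → -(t / 2) ≤ c → d ≤ t / 2 →
          w ∈ cRect (-t) t (-(t / 2)) (t / 2) := by
        intro w a b c d hw ha hb hc hd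
        have h := mem_cRect.1 hw
        exact mem_cRect.2 ⟨⟨by linarith [h.1.1], by linarith [h.1.2]⟩, by linarith [h.2.1], by linarith [h.2.2]⟩
      rintro w ((((hw | hw) | hw) | hw) | hw)
      · exact ⟨(hK₁ hw).1, hrect (hK₁ hw).2 (by linarith) (by linarith) (by linarith) (by linarith)⟩
      · exact ⟨(hUL hw).1, hrect (hUL hw).2 (by linarith) (by linarith) (by linarith) (by linarith)⟩
      · exact ⟨(hKT hw).1, hrect (hKT hw).2 (by linarith) (by linarith) (by linarith) (by linarith)⟩
      · exact ⟨(hUR hw).1, hrect (hUR hw).2 (by linarith) (by linarith) (by linarith) (by linarith)⟩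
      · exact ⟨(hK₂ hw).1, hrect (hK₂ hw).2 (by linarith) (by linarith) (by linarith) (by linarith)⟩
    · refine IsPreconnected.union w₂ (Or.inr hw₂U) hw₂K ?_ hK₂p
      refine IsPreconnected.union m₂ (Or.inr hm₂T) hm₂U ?_ hURp
      refine IsPreconnected.union m₁ (Or.inr hm₁U) hm₁T ?_ hKTp
      exact hK₁p.union w₁ hw₁K hw₁U hULp
  have hmono : μ.real (annEv s ∩ E₁ ∩ E₂) ≤ μ.real (lrCross (-t) t (-(t / 2)) (t / 2)) :=
    measureReal_mono hsub (measure_ne_top _ _)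
  have hshape : μ.real (lrCross (-t) t (-(t / 2)) (t / 2)) = μ.real (lrCross 0 (2 * t) 0 t) := by
    rw [measureReal_def, measureReal_def]
    exact congrArg ENNReal.toReal (measure_lrCross_eq_of_shape hB hW (by ring) (by ring))
  linarith

/-- **Lemma 3.1, conclusion: `P[A_t] ≥ c₃ = 2⁻⁹⁹⁵⁶`** when `P[A_s] ≥ 2⁻⁸²⁴`, `t ≥ 4s`, `α_t < s`
(`f_t(2) ≥ (3/16)² 2⁻⁸²⁴ ≥ 2⁻⁸²⁹`, chain to `f_t(4) ≥ 2⁻²⁴⁸⁹`, Cor. 1.3 (3)). [cite: Tassion2016, Lemma 3.1] -/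
theorem measureReal_annEv_ge_cThree (hB : IsPoissonPointProcess (volume : Measure ℂ) PB)
    (hW : IsPoissonPointProcess (volume : Measure ℂ) PW) (hs : 0 < s) (hts : 4 * s ≤ t)
    (hαt : alphaS (PB.prod PW) t < s) (hA : ((1 : ℝ) / 2) ^ 824 ≤ (PB.prod PW).real (annEv s)) :
    ((1 : ℝ) / 2) ^ 9956 ≤ (PB.prod PW).real (annEv t) := by
  haveI := hB.isProbabilityMeasure; haveI := hW.isProbabilityMeasure
  set μ := PB.prod PW with hμ
  have ht : 0 < t := by linarith
  have hf2' := measureReal_f2_ge_of_annEv hB hW hs hts hαt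
  have h5 : ((1 : ℝ) / 2) ^ 829 ≤ (3 / 16) ^ 2 * ((1 : ℝ) / 2) ^ 824 := by
    rw [show ((1 : ℝ) / 2) ^ 829 = ((1 : ℝ) / 2) ^ 5 * ((1 : ℝ) / 2) ^ 824 by rw [← pow_add]]
    exact mul_le_mul_of_nonneg_right (by norm_num) (by positivity)
  have hf2 : ((1 : ℝ) / 2) ^ 829 ≤ μ.real (lrCross 0 (2 * t) 0 t) :=
    h5.trans ((mul_le_mul_of_nonneg_left hA (by norm_num)).trans hf2')
  have hf1 : 1 / 2 ≤ μ.real (lrCross 0 t 0 t) := half_le_measureReal_lrCross_square hB hW ht (by ring)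
  have hch := measureReal_lrCross_chain hB hW ht one_pos 2
  have e1 : (1 + 1 : ℝ) * t = 2 * t := by ring
  have e2 : (1 + ((2 + 1 : ℕ) : ℝ) * 1) * t = 4 * t := by push_cast; ring
  rw [e1, e2] at hch
  have hf4 : ((1 : ℝ) / 2) ^ 2489 ≤ μ.real (lrCross 0 (4 * t) 0 t) := by
    refine le_trans ?_ hch
    calc ((1 : ℝ) / 2) ^ 2489 = (((1 : ℝ) / 2) ^ 829) ^ (2 + 1) * (1 / 2) ^ 2 := by
          rw [← pow_mul, ← pow_add]
      _ ≤ μ.real (lrCross 0 (2 * t) 0 t) ^ (2 + 1) * μ.real (lrCross 0 t 0 t) ^ 2 := by gcongr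
  rw [show ((1 : ℝ) / 2) ^ 9956 = (((1 : ℝ) / 2) ^ 2489) ^ 4 by rw [← pow_mul]]
  exact (pow_le_pow_left₀ (by positivity) hf4 4).trans (measureReal_annEv_ge hB hW)

end L31

/-! ### Lemma 3.2 -/

section L32

variable {PB PW : Measure (PointConfig ℂ)} {s : ℝ}

/-- **Lemma 3.2.**  Let `N` satisfy `(1 - c₃/2)^N < 1/8` (`c₃ = 2⁻⁹⁹⁵⁶`), let `s > 0` be beyond the
locality threshold (`P[(nucleiNear z u)ᶜ] ≤ c₃/2` for `u ≥ 27 s`) with `P[A_s] ≥ 2⁻⁸²⁴`.  Then some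
`s' ∈ [4s, C₁ s]`, `C₁ = 4 · 9^{N+1}`, has `α_{s'} ≥ s`.  (Scales in ratio `9` instead of
Tassion's `5`, because the locality regions of `VoronoiArmEstimatesProofs` are `u/2 < |x| < 9u/2`.)
[cite: Tassion2016, Lemma 3.2] -/
theorem exists_alphaS_ge (hB : IsPoissonPointProcess (volume : Measure ℂ) PB)
    (hW : IsPoissonPointProcess (volume : Measure ℂ) PW) (hs : 0 < s) {N : ℕ}
    (hN : (1 - ((1 : ℝ) / 2) ^ 9957) ^ N < 1 / 8)
    (hloc : ∀ u, 27 * s ≤ u → ∀ z, (PB.prod PW).real (nucleiNear z u)ᶜ ≤ ((1 : ℝ) / 2) ^ 9957)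
    (hA : ((1 : ℝ) / 2) ^ 824 ≤ (PB.prod PW).real (annEv s)) :
    ∃ s', 4 * s ≤ s' ∧ s' ≤ 4 * 9 ^ (N + 1) * s ∧ s ≤ alphaS (PB.prod PW) s' := by
  haveI := hB.isProbabilityMeasure; haveI := hW.isProbabilityMeasure
  set μ := PB.prod PW with hμ
  -- the two constants `c₃ = 2⁻⁹⁹⁵⁶` and `c₃/2`, kept as atoms
  have hhalf : ((1 : ℝ) / 2) ^ 9957 * 2 = ((1 : ℝ) / 2) ^ 9956 := by
    have key : ∀ x : ℝ, x ^ 9957 * 2 = x ^ 9956 * (x * 2) := fun x => by rw [pow_succ]; ring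
    rw [key, show ((1 : ℝ) / 2) * 2 = 1 by norm_num, mul_one]
  set c₃ : ℝ := ((1 : ℝ) / 2) ^ 9956 with hc₃
  set c₃' : ℝ := ((1 : ℝ) / 2) ^ 9957 with hc₃'
  clear_value c₃ c₃'
  by_contra hcon
  push Not at hcon
  set t : ℝ := 4 * 9 ^ (N + 1) * s with ht
  have h9N : (1 : ℝ) ≤ 9 ^ (N + 1) := one_le_pow₀ (by norm_num)
  have htpos : 0 < t := by rw [ht]; positivity
  have hts : 4 * s ≤ t := by rw [ht]; nlinarith
  -- the scales `t_j = 4 · 9^{j+1} s`, `j < N`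
  set tj : Fin N → ℝ := fun j => 4 * 9 ^ ((j : ℕ) + 1) * s with htj
  have htj4 : ∀ j, 4 * s ≤ tj j := fun j => by
    have : (1 : ℝ) ≤ 9 ^ ((j : ℕ) + 1) := one_le_pow₀ (by norm_num)
    simp only [htj]; nlinarith
  have htjt : ∀ j, tj j ≤ t := fun j => by
    simp only [htj, ht]
    have : (9 : ℝ) ^ ((j : ℕ) + 1) ≤ 9 ^ (N + 1) := pow_le_pow_right₀ (by norm_num) (by omega)
    nlinarith
  have htjt' : ∀ j, 4 * tj j ≤ t := fun j => by
    simp only [htj, ht]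
    have h1 : (9 : ℝ) ^ ((j : ℕ) + 1 + 1) ≤ 9 ^ (N + 1) := pow_le_pow_right₀ (by norm_num) (by omega)
    have h2 : (4 : ℝ) * 9 ^ ((j : ℕ) + 1) ≤ 9 ^ ((j : ℕ) + 1 + 1) := by
      have hp : (0 : ℝ) < 9 ^ ((j : ℕ) + 1) := by positivity
      calc (4 : ℝ) * 9 ^ ((j : ℕ) + 1) ≤ 9 * 9 ^ ((j : ℕ) + 1) := by linarith
        _ = 9 ^ ((j : ℕ) + 1 + 1) := by ring
    nlinarith
  have htjpos : ∀ j, 0 < tj j := fun j => by linarith [htj4 j]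
  -- Lemma 3.1 at each scale
  have hAj : ∀ j, c₃ ≤ μ.real (annEv (tj j)) := fun j => by
    rw [hc₃]; exact measureReal_annEv_ge_cThree hB hW hs (htj4 j) (hcon (tj j) (htj4 j) (htjt j)) hA
  clear hc₃ hc₃'
  -- the contradiction event `D = E₁ ∖ G`
  have hαt : alphaS μ t < s := hcon t hts le_rfl
  have hlt : alphaS μ t < t / 4 := by linarith
  set v : ℂ := ⟨-(t / 2), 0⟩ with hv
  have he : Isometry (Homeomorph.addRight (-v) : ℂ → ℂ) := isometry_addRight_neg v
  set E₁ : Set (PointConfig ℂ × PointConfig ℂ) := pairImage (Homeomorph.addRight (-v)) ⁻¹' hEv t 0 s with hE₁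
  set G : Set (PointConfig ℂ × PointConfig ℂ) := pairImage (Homeomorph.addRight (-v)) ⁻¹' hEv t s (t / 2) with hG
  have hE₁μ : μ.real E₁ = μ.real (hEv t 0 s) := by
    simp only [hE₁, measureReal_def, hμ]; rw [measure_preimage_pairImage_addRight hB hW]
  have hGμ : μ.real G = μ.real (hEv t s (t / 2)) := by
    simp only [hG, measureReal_def, hμ]; rw [measure_preimage_pairImage_addRight hB hW]
  have hdiff := measureReal_hEv_diff_ge hB hW htpos hlt hαt
  have hD : 1 / 8 ≤ μ.real (E₁ \ G) := by
    have h1 : μ.real E₁ ≤ μ.real (E₁ \ G) + μ.real G :=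
      (measureReal_mono (fun ω hω => by by_cases h : ω ∈ G; exacts [Or.inr h, Or.inl ⟨hω, h⟩]) (measure_ne_top _ _)).trans
        (measureReal_union_le _ _)
    linarith
  -- `D` is incompatible with each `A_{t_j}`
  have hDsub : E₁ \ G ⊆ ⋂ j, (annEv (tj j) ∩ nucleiNear 0 (3 * tj j / 4))ᶜ := by
    rintro ω ⟨hω₁, hωG⟩
    simp only [mem_iInter, mem_compl_iff]
    rintro j ⟨hωA, -⟩
    apply hωG
    rw [hE₁, mem_preimage] at hω₁
    obtain ⟨U_L, -, -, ⟨hUL, hULc, hULp, ⟨qh, hqh, hqhre, hqhim⟩, ⟨ql, hql, hqlre, hqlim⟩⟩, -, -, -, -⟩ :=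
      exists_hooks_of_mem_annEv (htjpos j) hωA
    obtain ⟨K₁, hK₁, hK₁c, hK₁p, ⟨a₁, ha₁, ha₁re⟩, ⟨p₁, hp₁, hp₁re, hp₁1, hp₁2⟩⟩ :=
      exists_continuum_of_mem_preimage_hEv hω₁
    simp only [hv] at hK₁ ha₁re hp₁re hp₁1 hp₁2
    have h4 := htjt' j
    have g₁ : (K₁ ∩ U_L).Nonempty := by
      refine inter_nonempty_of_gate_right (a := -(t / 2) - t / 2) (b := -(t / 2) + t / 2)
        (c := 0 - t / 2) (d := 0 + t / 2) (y := p₁.im) (by linarith) (by linarith) hK₁c hK₁p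
        (fun w hw => (hK₁ hw).2) ⟨a₁, ha₁, ha₁re⟩ ⟨p₁, hp₁, hp₁re, rfl⟩ hULc hULp ?_
        ⟨ql, hql, by rw [hqlre]; ring, by linarith [htjpos j]⟩ ⟨qh, hqh, by rw [hqhre]; ring, by linarith [htj4 j]⟩
      intro w hw
      have h := mem_cRect.1 (hUL hw).2
      exact mem_cRect.2 ⟨⟨by linarith [h.1.1], by linarith [h.1.2]⟩, by linarith [h.2.1], by linarith [h.2.2]⟩
    obtain ⟨w₁, hw₁K, hw₁U⟩ := g₁
    -- `K₁ ∪ U_L` witnesses `G`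
    rw [hG]
    show ω ∈ pairImage (Homeomorph.addRight (-v)) ⁻¹' blackCross (sqr t) {z | z.re = -(t / 2)} (rseg t s (t / 2))
    rw [preimage_pairImage_blackCross he, preimage_addRight_neg_sqr]
    have hqhR := mem_cRect.1 (hUL hqh).2
    refine ⟨K₁ ∪ U_L, ?_, hK₁c.union hULc, hK₁p.union w₁ hw₁K hw₁U hULp, ⟨a₁, Or.inl ha₁, ?_⟩, ⟨qh, Or.inr hqh, ?_⟩⟩
    · rintro w (hw | hw)
      · exact ⟨(hK₁ hw).1, by simpa [hv] using (hK₁ hw).2⟩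
      · refine ⟨(hUL hw).1, ?_⟩
        have h := mem_cRect.1 (hUL hw).2
        simp only [hv]
        exact mem_cRect.2 ⟨⟨by linarith [h.1.1], by linarith [h.1.2]⟩, by linarith [h.2.1], by linarith [h.2.2]⟩
    · simp only [mem_preimage, Homeomorph.coe_addRight, mem_setOf_eq, add_re, neg_re, hv]
      linarith
    · simp only [mem_preimage, Homeomorph.coe_addRight, rseg, mem_setOf_eq, add_re, neg_re, add_im, neg_im, hv]
      refine ⟨by linarith, by linarith [htj4 j], by linarith [hqhR.2.2]⟩
  -- independence across the scales `t_j` (locality regions of `u_j = 27 s · 9^j` are disjoint)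
  have hu : ∀ j : Fin N, 3 * tj j / 4 = 27 * s * 9 ^ (j : ℕ) := fun j => by
    simp only [htj]; rw [pow_succ]; ring
  have hmeasM : ∀ j : Fin N, MeasurableSet (annEv (tj j) ∩ nucleiNear 0 (3 * tj j / 4)) := fun j =>
    (measurableSet_annEv _).inter (measurableSet_nucleiNear _ _)
  have hind : μ (⋂ j, (annEv (tj j) ∩ nucleiNear 0 (3 * tj j / 4))ᶜ) =
      ∏ j, μ (annEv (tj j) ∩ nucleiNear 0 (3 * tj j / 4))ᶜ := by
    have hM : ∀ j : Fin N, (annEv (tj j) ∩ nucleiNear 0 (3 * tj j / 4))ᶜ =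
        restrictPair (localityRegion 0 (27 * s * 9 ^ (j : ℕ))) ⁻¹' (annEv (tj j) ∩ nucleiNear 0 (3 * tj j / 4))ᶜ := by
      intro j
      rw [preimage_compl, ← hu j, preimage_restrictPair_annLoc (htjpos j)]
    have h := measure_iInter_restrictPair_preimage hB hW (n := N)
      (D := fun j => localityRegion 0 (27 * s * 9 ^ (j : ℕ)))
      (fun j => measurableSet_localityRegion _ _) (pairwise_disjoint_localityRegion 0 (by positivity) N)
      (M := fun j => (annEv (tj j) ∩ nucleiNear 0 (3 * tj j / 4))ᶜ) (fun j => (hmeasM j).compl)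
    simp only [← hM] at h
    exact h
  have hfactor : ∀ j, μ.real (annEv (tj j) ∩ nucleiNear 0 (3 * tj j / 4))ᶜ ≤ 1 - c₃' := by
    intro j
    have h1 : μ.real (annEv (tj j)) ≤ μ.real (annEv (tj j) ∩ nucleiNear 0 (3 * tj j / 4)) +
        μ.real (nucleiNear 0 (3 * tj j / 4))ᶜ :=
      (measureReal_mono (fun ω hω => by
        by_cases h : ω ∈ nucleiNear 0 (3 * tj j / 4); exacts [Or.inl ⟨hω, h⟩, Or.inr h]) (measure_ne_top _ _)).trans
        (measureReal_union_le _ _)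
    have h2 := hloc (3 * tj j / 4) (by rw [hu j]; have : (1:ℝ) ≤ 9 ^ (j : ℕ) := one_le_pow₀ (by norm_num); nlinarith) 0
    rw [probReal_compl_eq_one_sub (hmeasM j)]
    linarith [hAj j]
  have hprod : μ.real (⋂ j, (annEv (tj j) ∩ nucleiNear 0 (3 * tj j / 4))ᶜ) ≤ (1 - c₃') ^ N := by
    rw [measureReal_def, hind, ENNReal.toReal_prod]
    calc ∏ j, (μ (annEv (tj j) ∩ nucleiNear 0 (3 * tj j / 4))ᶜ).toReal ≤ ∏ _j : Fin N, (1 - c₃') :=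
          Finset.prod_le_prod (fun j _ => ENNReal.toReal_nonneg) fun j _ => hfactor j
      _ = (1 - c₃') ^ N := by simp
  have hfin : μ.real (E₁ \ G) ≤ (1 - c₃') ^ N :=
    (measureReal_mono hDsub (measure_ne_top _ _)).trans hprod
  linarith

end L32

/-! ### Lemma 3.3: good scales with bounded gaps -/

section L33

variable {PB PW : Measure (PointConfig ℂ)}

/-- Growth of `α` along the scales `x (3/2)^k` when none of them is good (a scale that is not
good has `α_s > 2 α_{2s/3}`). [cite: Tassion2016, §2 Comment and Lemma 3.3] -/
theorem alphaS_growth {μ : Measure (PointConfig ℂ × PointConfig ℂ)} {x : ℝ} (k : ℕ)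
    (h : ∀ i, 1 ≤ i → i ≤ k → ¬ (alphaS μ (x * (3 / 2) ^ i) = x * (3 / 2) ^ i / 4 ∨
      alphaS μ (x * (3 / 2) ^ i) ≤ 2 * alphaS μ (2 * (x * (3 / 2) ^ i) / 3))) :
    2 ^ k * alphaS μ x ≤ alphaS μ (x * (3 / 2) ^ k) := by
  induction k with
  | zero => simp
  | succ k ih =>
    have hk := h (k + 1) (by omega) le_rfl
    push Not at hk
    have hk2 := hk.2
    have e : 2 * (x * (3 / 2) ^ (k + 1)) / 3 = x * (3 / 2) ^ k := by rw [pow_succ]; ring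
    rw [e] at hk2
    have ih' := ih fun i hi hik => h i hi (by omega)
    rw [pow_succ]
    nlinarith

/-- **Good scales exist beyond every threshold** (`α_s ≤ s/4` cannot grow super-linearly).
[cite: Tassion2016, proof of Lemma 3.3] -/
theorem exists_isGoodScale_ge (hB : IsPoissonPointProcess (volume : Measure ℂ) PB)
    (hW : IsPoissonPointProcess (volume : Measure ℂ) PW) {x : ℝ} (hx : 0 < x) :
    ∃ s, x ≤ s ∧ (alphaS (PB.prod PW) s = s / 4 ∨
      alphaS (PB.prod PW) s ≤ 2 * alphaS (PB.prod PW) (2 * s / 3)) := by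
  set μ := PB.prod PW with hμ
  by_contra hcon
  push Not at hcon
  have hng : ∀ k : ℕ, ¬ (alphaS μ (x * (3 / 2) ^ k) = x * (3 / 2) ^ k / 4 ∨
      alphaS μ (x * (3 / 2) ^ k) ≤ 2 * alphaS μ (2 * (x * (3 / 2) ^ k) / 3)) := fun k => by
    have := hcon _ (le_mul_of_one_le_right hx.le (one_le_pow₀ (by norm_num) : (1 : ℝ) ≤ (3 / 2) ^ k))
    push Not
    exact this
  -- `α` at scale `3x/2` is positive
  set y : ℝ := x * (3 / 2) with hy
  have hy0 : 0 < y := by positivity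
  have hαy : 0 < alphaS μ y := by
    have h := hng 1
    push Not at h
    have h2 := h.2
    rw [pow_one, show 2 * (x * (3 / 2)) / 3 = x by ring] at h2
    linarith [alphaS_nonneg hB hW hx]
  -- growth from `y`
  have hgrow : ∀ k : ℕ, 2 ^ k * alphaS μ y ≤ y * (3 / 2) ^ k / 4 := fun k => by
    have h := alphaS_growth (μ := μ) (x := y) k fun i _ _ => by
      rw [hy, mul_assoc, ← pow_succ']; exact hng (i + 1)
    exact h.trans (alphaS_le hB hW (by positivity))
  have hlim : Tendsto (fun k : ℕ => ((4 : ℝ) / 3) ^ k) atTop atTop :=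
    tendsto_pow_atTop_atTop_of_one_lt (by norm_num)
  obtain ⟨k, hk⟩ := (hlim.eventually (eventually_gt_atTop (y / (4 * alphaS μ y)))).exists
  have h := hgrow k
  have h43 : ((4 : ℝ) / 3) ^ k * (3 / 2) ^ k = 2 ^ k := by rw [← mul_pow]; norm_num
  rw [div_lt_iff₀ (by positivity)] at hk
  nlinarith [pow_pos (by norm_num : (0 : ℝ) < (3 / 2)) k]

/-- **Lemma 3.3, one step**: after a good scale `s` (beyond the locality threshold) there is a good
scale in `[4s, C₃ s]`, `C₃ = C₁ (3/2)^{k₀}` for any `k₀` with `(4/3)^{k₀} ≥ C₁/4` (Lemma 3.2 gives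
`s'` with `α_{s'} ≥ s'/C₁`; if no `s'(3/2)^k`, `k ≤ k₀`, were good, `α` would double at each step).
[cite: Tassion2016, Lemma 3.3] -/
theorem exists_isGoodScale_mem_Icc (hB : IsPoissonPointProcess (volume : Measure ℂ) PB)
    (hW : IsPoissonPointProcess (volume : Measure ℂ) PW) {s : ℝ} (hs : 0 < s) {N k₀ : ℕ}
    (hN : (1 - ((1 : ℝ) / 2) ^ 9957) ^ N < 1 / 8) (hk₀ : (9 : ℝ) ^ (N + 1) ≤ ((4 : ℝ) / 3) ^ k₀)
    (hloc : ∀ u, 27 * s ≤ u → ∀ z, (PB.prod PW).real (nucleiNear z u)ᶜ ≤ ((1 : ℝ) / 2) ^ 9957)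
    (hgood : alphaS (PB.prod PW) s = s / 4 ∨ alphaS (PB.prod PW) s ≤ 2 * alphaS (PB.prod PW) (2 * s / 3)) :
    ∃ s'', 4 * s ≤ s'' ∧ s'' ≤ 4 * 9 ^ (N + 1) * (3 / 2) ^ k₀ * s ∧
      (alphaS (PB.prod PW) s'' = s'' / 4 ∨
        alphaS (PB.prod PW) s'' ≤ 2 * alphaS (PB.prod PW) (2 * s'' / 3)) := by
  set μ := PB.prod PW with hμ
  obtain ⟨s', h4, hC, hα⟩ := exists_alphaS_ge hB hW hs hN hloc (measureReal_annEv_ge_of_good hB hW hs hgood)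
  have hs' : 0 < s' := by linarith
  have h9N : (1 : ℝ) ≤ 9 ^ (N + 1) := one_le_pow₀ (by norm_num)
  have hP1 : (1 : ℝ) ≤ (3 / 2) ^ k₀ := one_le_pow₀ (by norm_num)
  by_contra hcon
  push Not at hcon
  have hng : ∀ i, 1 ≤ i → i ≤ k₀ → ¬ (alphaS μ (s' * (3 / 2) ^ i) = s' * (3 / 2) ^ i / 4 ∨
      alphaS μ (s' * (3 / 2) ^ i) ≤ 2 * alphaS μ (2 * (s' * (3 / 2) ^ i) / 3)) := by
    intro i _ hi
    have hmem1 : 4 * s ≤ s' * (3 / 2) ^ i :=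
      h4.trans (le_mul_of_one_le_right hs'.le (one_le_pow₀ (by norm_num)))
    have hmem2 : s' * (3 / 2) ^ i ≤ 4 * 9 ^ (N + 1) * (3 / 2) ^ k₀ * s := by
      have : ((3 : ℝ) / 2) ^ i ≤ (3 / 2) ^ k₀ := pow_le_pow_right₀ (by norm_num) hi
      have hC1s : 0 ≤ 4 * 9 ^ (N + 1) * s := by positivity
      calc s' * (3 / 2) ^ i ≤ (4 * 9 ^ (N + 1) * s) * (3 / 2) ^ k₀ := mul_le_mul hC this (by positivity) hC1s
        _ = 4 * 9 ^ (N + 1) * (3 / 2) ^ k₀ * s := by ring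
    have := hcon _ hmem1 hmem2
    push Not
    exact this
  -- `k₀ ≥ 1` (since `9 ≤ (4/3)^{k₀}`)
  have hk₀pos : 0 < k₀ := by
    rcases Nat.eq_zero_or_pos k₀ with h0 | hpos
    · rw [h0, pow_zero] at hk₀
      have : (9 : ℝ) ≤ 9 ^ (N + 1) := by
        calc (9 : ℝ) = 9 ^ 1 := by norm_num
          _ ≤ 9 ^ (N + 1) := pow_le_pow_right₀ (by norm_num) (by omega)
      linarith
    · exact hpos
  -- strict growth: first step strict, then `alphaS_growth`
  have hk1 := hng 1 le_rfl hk₀pos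
  push Not at hk1
  have hk1' := hk1.2
  rw [pow_one, show 2 * (s' * (3 / 2)) / 3 = s' by ring] at hk1'
  have hrest := alphaS_growth (μ := μ) (x := s' * (3 / 2)) (k₀ - 1) fun i hi hik => by
    rw [mul_assoc, ← pow_succ']; exact hng (i + 1) (by omega) (by omega)
  have e : s' * (3 / 2) * (3 / 2) ^ (k₀ - 1) = s' * (3 / 2) ^ k₀ := by
    rw [mul_assoc, ← pow_succ']; congr 2; omega
  rw [e] at hrest
  have e2 : (2 : ℝ) ^ k₀ = 2 ^ (k₀ - 1) * 2 := by rw [← pow_succ]; congr 1; omega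
  have hup : alphaS μ (s' * (3 / 2) ^ k₀) ≤ s' * (3 / 2) ^ k₀ / 4 := alphaS_le hB hW (by positivity)
  set P : ℝ := (3 / 2) ^ k₀ with hP
  set R : ℝ := (4 / 3) ^ k₀ with hR
  have hPpos : 0 < P := by positivity
  have h43 : R * P = 2 ^ k₀ := by rw [hR, hP, ← mul_pow]; norm_num
  have hQ1 : 0 < (2 : ℝ) ^ (k₀ - 1) := by positivity
  -- chain of inequalities
  have i0 : 2 ^ (k₀ - 1) * 2 * alphaS μ s' < alphaS μ (s' * P) := by nlinarith
  have i1 : 2 ^ (k₀ - 1) * 2 * s ≤ 2 ^ (k₀ - 1) * 2 * alphaS μ s' := mul_le_mul_of_nonneg_left hα (by positivity)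
  have i2 : s' * P / 4 ≤ 4 * 9 ^ (N + 1) * s * P / 4 := by
    have := mul_le_mul_of_nonneg_right hC hPpos.le
    linarith
  have i3 : 4 * 9 ^ (N + 1) * s * P / 4 ≤ R * s * P := by
    have hsP : 0 ≤ s * P := by positivity
    have := mul_le_mul_of_nonneg_right hk₀ hsP
    nlinarith
  have i4 : R * s * P = 2 ^ (k₀ - 1) * 2 * s := by rw [← e2, ← h43]; ring
  linarith

/-- **The sequence of good scales** `g₀ < g₁ < ⋯` with `4 gₖ ≤ gₖ₊₁ ≤ C₃ gₖ`, all beyond `s₀`.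
[cite: Tassion2016, Lemma 3.3] -/
theorem exists_goodSeq (hB : IsPoissonPointProcess (volume : Measure ℂ) PB)
    (hW : IsPoissonPointProcess (volume : Measure ℂ) PW) {s₀ : ℝ} (hs₀ : 0 < s₀) {N k₀ : ℕ}
    (hN : (1 - ((1 : ℝ) / 2) ^ 9957) ^ N < 1 / 8) (hk₀ : (9 : ℝ) ^ (N + 1) ≤ ((4 : ℝ) / 3) ^ k₀)
    (hloc : ∀ u, 27 * s₀ ≤ u → ∀ z, (PB.prod PW).real (nucleiNear z u)ᶜ ≤ ((1 : ℝ) / 2) ^ 9957) :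
    ∃ g : ℕ → ℝ, s₀ ≤ g 0 ∧ (∀ k, alphaS (PB.prod PW) (g k) = g k / 4 ∨
      alphaS (PB.prod PW) (g k) ≤ 2 * alphaS (PB.prod PW) (2 * g k / 3)) ∧
      ∀ k, 4 * g k ≤ g (k + 1) ∧ g (k + 1) ≤ 4 * 9 ^ (N + 1) * (3 / 2) ^ k₀ * g k := by
  set μ := PB.prod PW with hμ
  have step : ∀ x : {x : ℝ // s₀ ≤ x ∧ (alphaS μ x = x / 4 ∨ alphaS μ x ≤ 2 * alphaS μ (2 * x / 3))},
      ∃ y : {x : ℝ // s₀ ≤ x ∧ (alphaS μ x = x / 4 ∨ alphaS μ x ≤ 2 * alphaS μ (2 * x / 3))},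
        4 * x.1 ≤ y.1 ∧ y.1 ≤ 4 * 9 ^ (N + 1) * (3 / 2) ^ k₀ * x.1 := by
    rintro ⟨x, hx₀, hxg⟩
    have hx : 0 < x := hs₀.trans_le hx₀
    obtain ⟨y, h4, hC, hyg⟩ := exists_isGoodScale_mem_Icc hB hW hx hN hk₀
      (fun u hu z => hloc u (by nlinarith) z) hxg
    exact ⟨⟨y, by linarith, hyg⟩, h4, hC⟩
  choose F hF using step
  obtain ⟨x₀, hx₀, hx₀g⟩ := exists_isGoodScale_ge hB hW hs₀
  set G : ℕ → {x : ℝ // s₀ ≤ x ∧ (alphaS μ x = x / 4 ∨ alphaS μ x ≤ 2 * alphaS μ (2 * x / 3))} :=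
    fun k => F^[k] ⟨x₀, hx₀, hx₀g⟩ with hG
  refine ⟨fun k => (G k).1, hx₀, fun k => (G k).2.2, fun k => ?_⟩
  have : G (k + 1) = F (G k) := by simp only [hG]; rw [Function.iterate_succ_apply']
  show 4 * (G k).1 ≤ (G (k + 1)).1 ∧ (G (k + 1)).1 ≤ 4 * 9 ^ (N + 1) * (3 / 2) ^ k₀ * (G k).1
  rw [this]
  exact hF (G k)

end L33

/-! ### Theorem 1 (weak continuum form, `ρ = 4`) and the one-arm estimate -/

section Final

variable {PB PW : Measure (PointConfig ℂ)}

/-- **Tassion's Theorem 1 at `p = 1/2` for weak-black continuum crossings, `ρ = 4`**: the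
left–right crossing probability of `[0, 4s] × [0, s]` is bounded below at all large scales.
Fix `N` with `(1 - c₃/2)^N < 1/8`, `k₀` with `(4/3)^{k₀} ≥ 9^{N+1}`, `C₃ = 4·9^{N+1}(3/2)^{k₀}`, the
locality threshold `s₀` (Lemma 1.1), and the good scales `gₖ` (gaps `≤ C₃`); for `s ≥ 8 g₀` some good
`g ∈ (s/(8C₃), s/8]` has `f_g(4) ≥ 2⁻²⁰⁶`, and `⌈32 C₃/3⌉ + 1` chained pieces (Cor. 1.3 (2)) cross
`[0, 4s] × [0, g] ⊆ [0, 4s] × [0, s]`. [cite: Tassion2016, Thm 1 and §3] -/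
theorem weakRSW (hB : IsPoissonPointProcess (volume : Measure ℂ) PB)
    (hW : IsPoissonPointProcess (volume : Measure ℂ) PW) :
    ∃ c₁ s₁ : ℝ, 0 < c₁ ∧ 0 < s₁ ∧ ∀ s, s₁ ≤ s → c₁ ≤ (PB.prod PW).real (lrCross 0 (4 * s) 0 s) := by
  haveI := hB.isProbabilityMeasure; haveI := hW.isProbabilityMeasure
  set μ := PB.prod PW with hμ
  -- the absolute constants `N`, `k₀`, `C₃`
  obtain ⟨N, hN⟩ : ∃ N : ℕ, (1 - ((1 : ℝ) / 2) ^ 9957) ^ N < 1 / 8 :=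
    exists_pow_lt_of_lt_one (by norm_num) (sub_lt_self 1 (by positivity))
  obtain ⟨k₀, hk₀⟩ : ∃ k : ℕ, (9 : ℝ) ^ (N + 1) ≤ ((4 : ℝ) / 3) ^ k :=
    ((tendsto_pow_atTop_atTop_of_one_lt (by norm_num : (1 : ℝ) < 4 / 3)).eventually
      (eventually_ge_atTop ((9 : ℝ) ^ (N + 1)))).exists
  set C₃ : ℝ := 4 * 9 ^ (N + 1) * (3 / 2) ^ k₀ with hC₃
  have hC₃4 : 4 ≤ C₃ := by
    have h1 : (1 : ℝ) ≤ 9 ^ (N + 1) := one_le_pow₀ (by norm_num)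
    have h2 : (1 : ℝ) ≤ (3 / 2) ^ k₀ := one_le_pow₀ (by norm_num)
    rw [hC₃]; nlinarith
  -- locality threshold
  obtain ⟨U, hU, hUloc⟩ := exists_forall_measureReal_compl_nucleiNear_le hB hW
    (by positivity : (0 : ℝ) < ((1 : ℝ) / 2) ^ 9957)
  set s₀ : ℝ := U / 27 with hs₀
  have hs₀pos : 0 < s₀ := by positivity
  obtain ⟨g, hg₀, hgood, hgap⟩ := exists_goodSeq hB hW hs₀pos hN hk₀
    (fun u hu z => hUloc u (by rw [hs₀] at hu; linarith) z)
  have hgpos : ∀ k, 0 < g k := by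
    intro k
    induction k with
    | zero => exact hs₀pos.trans_le hg₀
    | succ k ih => linarith [(hgap k).1]
  have hgmono : ∀ k, g 0 * 4 ^ k ≤ g k := by
    intro k
    induction k with
    | zero => simp
    | succ k ih => rw [pow_succ]; nlinarith [(hgap k).1]
  -- constants of the conclusion
  set M : ℕ := ⌈32 * C₃ / 3⌉₊ with hM
  set c₁ : ℝ := (((1 : ℝ) / 2) ^ 206) ^ (M + 1) * (1 / 2) ^ M with hc₁
  refine ⟨c₁, 8 * g 0, by positivity, by linarith [hgpos 0], fun s hs => ?_⟩
  have hspos : 0 < s := by linarith [hgpos 0]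
  -- the good scale just below `s/8`
  have hex : ∃ k, s / 8 < g (k + 1) := by
    have hlim : Tendsto (fun k : ℕ => g 0 * 4 ^ k) atTop atTop :=
      (tendsto_pow_atTop_atTop_of_one_lt (by norm_num : (1 : ℝ) < 4)).const_mul_atTop (hgpos 0)
    obtain ⟨k, hk⟩ := (hlim.eventually (eventually_gt_atTop (s / 8))).exists
    exact ⟨k, by linarith [hgmono k, (hgap k).1, hgpos k]⟩
  classical
  set k := Nat.find hex with hk
  have hk1 : s / 8 < g (k + 1) := Nat.find_spec hex
  have hk0 : g k ≤ s / 8 := by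
    rcases Nat.eq_zero_or_pos k with h0 | hpos
    · rw [h0]; linarith
    · have hmin := Nat.find_min hex (m := k - 1) (by rw [← hk]; omega)
      rw [not_lt] at hmin
      have e : k - 1 + 1 = k := by omega
      rw [e] at hmin
      exact hmin
  set a := g k with ha
  have hapos : 0 < a := hgpos k
  have halow : s / (8 * C₃) < a := by
    have h := (hgap k).2
    rw [div_lt_iff₀ (by linarith)]
    nlinarith
  -- `f_a(4) ≥ 2⁻²⁰⁶`, chain `M + 1` pieces of length `4a` with overlaps `a` (κ = 3)
  have hf4 : ((1 : ℝ) / 2) ^ 206 ≤ μ.real (lrCross 0 (4 * a) 0 a) := measureReal_f4_ge_of_good hB hW hapos (hgood k)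
  have hf1 : 1 / 2 ≤ μ.real (lrCross 0 a 0 a) := half_le_measureReal_lrCross_square hB hW hapos (by ring)
  have hch := measureReal_lrCross_chain hB hW hapos (by norm_num : (0 : ℝ) < 3) M
  rw [show (1 + 3 : ℝ) * a = 4 * a by ring] at hch
  set X : ℝ := (1 + ((M + 1 : ℕ) : ℝ) * 3) * a with hX
  have hX4s : 4 * s ≤ X := by
    have hM' : 32 * C₃ / 3 ≤ (M : ℝ) := Nat.le_ceil _
    rw [hX]; push_cast
    have : 4 * s < 32 * C₃ * a := by
      rw [div_lt_iff₀ (by linarith)] at halow; linarith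
    nlinarith
  have hle1 : c₁ ≤ μ.real (lrCross 0 X 0 a) := by
    refine le_trans ?_ hch
    rw [hc₁]
    gcongr
  have hsub : lrCross 0 X 0 a ⊆ lrCross 0 (4 * s) 0 s :=
    (lrCross_subset_of_le (by linarith) hX4s).trans (lrCross_subset_of_band le_rfl (by linarith))
  exact hle1.trans (measureReal_mono hsub (measure_ne_top _ _))

/-- **Tassion's annealed one-arm estimate (Theorem 3 (2)) — the named fact `VoronoiAnnealedOneArm`.**
Weak-black RSW (`weakRSW`, Thm 1 at `p = 1/2`) ⇒ white blocking crossings with positive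
probability at every scale (FKG, colour symmetry) ⇒ strict annulus crossings have probability
`≤ 1 - c` ⇒ multi-scale independence (locality) ⇒ polynomial decay of strict arms ⇒ (a.s.
weak-to-strict surgery, rescaling) the mesh-uniform annealed bound.
[cite: Tassion2016, Thm 3 (2) (with Thm 1, §4)] -/
theorem VoronoiAnnealedOneArm_holds : VoronoiAnnealedOneArm :=
  VoronoiAnnealedOneArm_of_weakRSW fun _ _ hB hW => weakRSW hB hW

end Final

end Literature.Probability.Percolation
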